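import Mathlib
import HarnessLib
import Literature.NumberTheory.DiophantineGeometry.BelyiDegree
import Literature.NumberTheory.DiophantineGeometry.BelyiPolynomialHeightProofs

/-!
# Belyi pairs `(p, q)` of degree `d` and their Wronskian

Topic `Literature/NumberTheory/DiophantineGeometry`; companion of `BelyiDegree.lean`.  There,
`HasBelyiWitness d t` says that the four-pointed line `(ℙ¹; 0, 1, ∞, t)` carries a Belyi map of
degree `d` in the normal form "`∞` special": coprime `p, q ∈ K[X]`, `max (deg p) (deg q) = d`, one
of `deg p, deg q, deg (p - q)` drops below `d`, and `p q (p - q)` has exactly `d + 1` distinct roots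
(the Riemann–Hurwitz equality case for the rational map `p/q`).  This file isolates the first part as
a predicate `IsBelyiPair d p q` on a pair of polynomials over any field (no reference to the points
`0, 1, t`), records its symmetries, and proves the basic algebraic consequence that drives every
reduction argument about such maps:

* `IsBelyiPair.swap` (`p/q ↦ q/p`), `IsBelyiPair.oneSub` (`p/q ↦ 1 - p/q = (q - p)/q`),
  `IsBelyiPair.comp` (precomposition with an affine substitution `X ↦ s + cX`, `c ≠ 0`);
* `hasBelyiWitness_iff` — `HasBelyiWitness d t ↔ ∃ p q, IsBelyiPair d p q ∧ (pq(p-q))(0,1,t) = 0`;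
* **the Wronskian of a Belyi pair** (`wronskian p q = p q' - p' q`, Mathlib): in characteristic `0`
  it is non-zero and, when `p q (p - q)` splits (e.g. over `ℂ`),
  `wronskian p q = c · ∏_{s} (X - s)^{e_s - 1}` over the distinct roots `s` of `p q (p - q)` with
  their multiplicities `e_s` (`wronskian_eq_C_mul_prod`) — the equality case of the Mason–Stothers
  argument (Mathlib `Polynomial.abc`): `∏ (X - s)^{e_s - 1}` divides the Wronskian, and both have
  degree `deg(pq(p-q)) - d - 1`.  Consequently the roots of the Wronskian lie among the special
  points, with multiplicity `e_s - 1` (`rootMultiplicity_wronskian`), and for every predicate `P` on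
  `K` the number of roots of the Wronskian satisfying `P` is
  `#{roots of pq(p-q) with P} - #{distinct roots with P}` (`card_roots_wronskian_filter`): on a disc,
  "`n(W) = M₀ + M₁ + M_∞ - N`".

All statements are folklore (Riemann–Hurwitz for `ℙ¹ → ℙ¹` in the language of Mason–Stothers; e.g.
Lando–Zvonkin, *Graphs on Surfaces*, §2.2, or the proof of `Polynomial.abc`).  Everything is proved.
-/

noncomputable section

open Polynomial
open scoped Classical

namespace Literature.NumberTheory.DiophantineGeometry

variable {K : Type*} [Field K]

/-- `IsBelyiPair d p q`: the pair `(p, q)` presents a Belyi map `p/q : ℙ¹ → ℙ¹` of degree `d` with `∞`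
special, in the root-count normal form of `HasBelyiWitness` — `p, q` coprime,
`max (deg p) (deg q) = d`, one of `deg p, deg q, deg (p - q)` is `< d`, and `p q (p - q)` has exactly
`d + 1` distinct roots. [folklore] -/
structure IsBelyiPair (d : ℕ) (p q : K[X]) : Prop where
  /-- `p` and `q` are coprime. -/
  isCoprime : IsCoprime p q
  /-- the map `p/q` has degree `d`. -/
  natDegree_eq : max p.natDegree q.natDegree = d
  /-- `∞` lies over `0`, `∞` or `1`. -/
  drop : p.natDegree < d ∨ q.natDegree < d ∨ (p - q).natDegree < d
  /-- `p q (p - q)` has `d + 1` distinct roots (Riemann–Hurwitz equality). -/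
  card_roots : (p * q * (p - q)).roots.toFinset.card = d + 1

/-- `HasBelyiWitness d t` unfolds to the existence of a Belyi pair through `0, 1, t`. [folklore] -/
theorem hasBelyiWitness_iff_exists_isBelyiPair (d : ℕ) (t : ℂ) :
    HasBelyiWitness d t ↔ ∃ p q : ℂ[X], IsBelyiPair d p q ∧
      (p * q * (p - q)).eval 0 = 0 ∧ (p * q * (p - q)).eval 1 = 0 ∧ (p * q * (p - q)).eval t = 0 := by
  constructor
  · rintro ⟨p, q, hcop, hmax, hdrop, hcard, h0, h1, ht⟩
    exact ⟨p, q, ⟨hcop, hmax, hdrop, hcard⟩, h0, h1, ht⟩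
  · rintro ⟨p, q, ⟨hcop, hmax, hdrop, hcard⟩, h0, h1, ht⟩
    exact ⟨p, q, hcop, hmax, hdrop, hcard, h0, h1, ht⟩

namespace IsBelyiPair

variable {d : ℕ} {p q : K[X]}

/-- A Belyi pair has positive degree. [folklore] -/
theorem pos (h : IsBelyiPair d p q) : 0 < d := by
  rcases h.drop with h' | h' | h' <;> exact Nat.lt_of_le_of_lt (Nat.zero_le _) h'

/-- `p q (p - q) ≠ 0`. [folklore] -/
theorem prod_ne_zero (h : IsBelyiPair d p q) : p * q * (p - q) ≠ 0 := by
  intro hz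
  have := h.card_roots
  rw [hz, roots_zero, Multiset.toFinset_zero, Finset.card_empty] at this
  omega

/-- `p ≠ 0`. [folklore] -/
theorem left_ne_zero (h : IsBelyiPair d p q) : p ≠ 0 := fun hz =>
  h.prod_ne_zero (by rw [hz, zero_mul, zero_mul])

/-- `q ≠ 0`. [folklore] -/
theorem right_ne_zero (h : IsBelyiPair d p q) : q ≠ 0 := fun hz =>
  h.prod_ne_zero (by rw [hz, mul_zero, zero_mul])

/-- `p - q ≠ 0`. [folklore] -/
theorem sub_ne_zero (h : IsBelyiPair d p q) : p - q ≠ 0 := fun hz =>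
  h.prod_ne_zero (by rw [hz, mul_zero])

/-- `deg p ≤ d`. [folklore] -/
theorem natDegree_left_le (h : IsBelyiPair d p q) : p.natDegree ≤ d :=
  h.natDegree_eq ▸ le_max_left _ _

/-- `deg q ≤ d`. [folklore] -/
theorem natDegree_right_le (h : IsBelyiPair d p q) : q.natDegree ≤ d :=
  h.natDegree_eq ▸ le_max_right _ _

/-- `deg (p - q) ≤ d`. [folklore] -/
theorem natDegree_sub_le (h : IsBelyiPair d p q) : (p - q).natDegree ≤ d :=
  (Polynomial.natDegree_sub_le _ _).trans (max_le h.natDegree_left_le h.natDegree_right_le)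

/-- Exactly one of the three degrees drops: the other two equal `d`.  Stated as: the sum of the three
degrees is at least `2d` plus the smallest of them. [folklore] -/
theorem two_mul_le_sum_natDegree (h : IsBelyiPair d p q) :
    2 * d + min p.natDegree (min q.natDegree (p - q).natDegree) ≤
      p.natDegree + q.natDegree + (p - q).natDegree := by
  have hp := h.natDegree_left_le
  have hq := h.natDegree_right_le
  have hr := h.natDegree_sub_le
  have hmax := h.natDegree_eq
  -- if `deg p < d` then `deg q = d` and `deg (p - q) = d`, etc.
  have key : ∀ {a b : K[X]}, a.natDegree < d → b.natDegree = d → (a - b).natDegree = d := by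
    intro a b ha hb
    have : (a - b).natDegree = (b - a).natDegree := by rw [← natDegree_neg, neg_sub]
    rw [this]
    exact (natDegree_sub_eq_left_of_natDegree_lt (hb ▸ ha)).trans hb
  rcases h.drop with h' | h' | h'
  · have hqd : q.natDegree = d := by
      rcases max_eq_iff.mp hmax with ⟨h1, -⟩ | ⟨h1, -⟩ <;> omega
    have hrd : (p - q).natDegree = d := key h' hqd
    rw [hqd, hrd]; omega
  · have hpd : p.natDegree = d := by
      rcases max_eq_iff.mp hmax with ⟨h1, -⟩ | ⟨h1, -⟩ <;> omega
    have hrd : (p - q).natDegree = d := by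
      have := key h' hpd
      rwa [← natDegree_neg, neg_sub] at this
    rw [hpd, hrd]; omega
  · have hpd : p.natDegree = d := by
      by_contra hne
      have hlt : p.natDegree < d := lt_of_le_of_ne hp hne
      have hqd : q.natDegree = d := by
        rcases max_eq_iff.mp hmax with ⟨h1, -⟩ | ⟨h1, -⟩ <;> omega
      have := key hlt hqd
      omega
    have hqd : q.natDegree = d := by
      by_contra hne
      have hlt : q.natDegree < d := lt_of_le_of_ne hq hne
      have := key hlt hpd
      rw [← natDegree_neg, neg_sub] at this
      omega
    rw [hpd, hqd]; omega

/-! ### Symmetries -/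

/-- `p/q ↦ q/p`. [folklore] -/
theorem swap (h : IsBelyiPair d p q) : IsBelyiPair d q p where
  isCoprime := h.isCoprime.symm
  natDegree_eq := by rw [max_comm]; exact h.natDegree_eq
  drop := by
    have : (q - p).natDegree = (p - q).natDegree := by rw [← natDegree_neg, neg_sub]
    rw [this]
    rcases h.drop with h' | h' | h'
    · exact Or.inr (Or.inl h')
    · exact Or.inl h'
    · exact Or.inr (Or.inr h')
  card_roots := by
    have : q * p * (q - p) = -(p * q * (p - q)) := by ring
    rw [this, roots_neg]
    exact h.card_roots

/-- `p/q ↦ 1 - p/q = (q - p)/q`. [folklore] -/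
theorem oneSub (h : IsBelyiPair d p q) : IsBelyiPair d (q - p) q where
  isCoprime := by
    obtain ⟨u, v, huv⟩ := h.isCoprime
    exact ⟨-u, v + u, by linear_combination huv⟩
  natDegree_eq := by
    have hr : (q - p).natDegree = (p - q).natDegree := by rw [← natDegree_neg, neg_sub]
    apply le_antisymm (max_le (hr ▸ h.natDegree_sub_le) h.natDegree_right_le)
    have h2 := h.two_mul_le_sum_natDegree
    have hp := h.natDegree_left_le
    rw [hr]
    rcases le_or_gt d q.natDegree with hq | hq
    · exact hq.trans (le_max_right _ _)
    · have : d ≤ (p - q).natDegree := by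
        have := min_le_right p.natDegree (min q.natDegree (p - q).natDegree)
        have := min_le_left q.natDegree (p - q).natDegree
        omega
      exact this.trans (le_max_left _ _)
  drop := by
    have hr : (q - p).natDegree = (p - q).natDegree := by rw [← natDegree_neg, neg_sub]
    have hp : (q - p - q).natDegree = p.natDegree := by
      rw [sub_sub_cancel_left, natDegree_neg]
    rw [hr, hp]
    rcases h.drop with h' | h' | h'
    · exact Or.inr (Or.inr h')
    · exact Or.inr (Or.inl h')
    · exact Or.inl h'
  card_roots := by
    have : (q - p) * q * (q - p - q) = p * q * (p - q) := by ring
    rw [this]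
    exact h.card_roots

/-- An affine substitution `X ↦ s + cX` with `c ≠ 0`. [folklore] -/
theorem comp (h : IsBelyiPair d p q) (s : K) {c : K} (hc : c ≠ 0) :
    IsBelyiPair d (p.comp (C s + C c * X)) (q.comp (C s + C c * X)) := by
  set L : K[X] := C s + C c * X with hL
  have hLdeg : L.natDegree = 1 := by
    rw [hL, add_comm, natDegree_add_C, natDegree_C_mul_X c hc]
  have hdeg : ∀ f : K[X], (f.comp L).natDegree = f.natDegree := fun f => by
    rw [natDegree_comp, hLdeg, mul_one]
  have hsub : p.comp L - q.comp L = (p - q).comp L := (sub_comp).symm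
  refine ⟨?_, ?_, ?_, ?_⟩
  · obtain ⟨u, v, huv⟩ := h.isCoprime
    refine ⟨u.comp L, v.comp L, ?_⟩
    rw [← mul_comp, ← mul_comp, ← add_comp, huv, one_comp]
  · rw [hdeg, hdeg, h.natDegree_eq]
  · rw [hsub, hdeg, hdeg, hdeg]; exact h.drop
  · have key : p.comp L * q.comp L * (p.comp L - q.comp L) = (p * q * (p - q)).comp L := by
      rw [hsub, mul_comp, mul_comp]
    rw [key, hL, add_comm (C s), roots_comp_C_mul_X_add_C _ _ _ (Ne.isUnit hc),
      Multiset.toFinset_map, Finset.card_image_of_injective _ ?_, h.card_roots]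
    intro x y hxy
    have hinv : Ring.inverse c = c⁻¹ := congrFun Ring.inverse_eq_inv' c
    simp only [hinv] at hxy
    have := mul_left_cancel₀ (inv_ne_zero hc) hxy
    simpa using this

end IsBelyiPair

/-! ### The Wronskian of a Belyi pair -/

section Wronskian

variable {d : ℕ} {p q : K[X]}

/-- If `g^m ∣ f` then `g^(m-1) ∣ f'`. [folklore] -/
theorem pow_sub_one_dvd_derivative_of_pow_dvd {f g : K[X]} {m : ℕ} (h : g ^ m ∣ f) :
    g ^ (m - 1) ∣ derivative f := by
  obtain ⟨u, rfl⟩ := h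
  rw [derivative_mul, derivative_pow]
  refine dvd_add (Dvd.dvd.mul_right (Dvd.dvd.mul_right ?_ _) _) (Dvd.dvd.mul_right ?_ _)
  · exact Dvd.intro_left _ rfl
  · exact pow_dvd_pow g (Nat.sub_le m 1)

/-- `(X - s)^{e - 1}` divides the Wronskian `p q' - p' q` when `e` is the multiplicity of `s` as a
root of `p`. [folklore] -/
theorem pow_rootMultiplicity_sub_one_dvd_wronskian (p q : K[X]) (s : K) :
    (X - C s) ^ (p.rootMultiplicity s - 1) ∣ wronskian p q := by
  have h1 : (X - C s) ^ p.rootMultiplicity s ∣ p := pow_rootMultiplicity_dvd p s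
  have h2 := pow_sub_one_dvd_derivative_of_pow_dvd h1
  have h1' : (X - C s) ^ (p.rootMultiplicity s - 1) ∣ p :=
    (pow_dvd_pow _ (Nat.sub_le _ 1)).trans h1
  unfold wronskian
  exact dvd_sub (h1'.mul_right _) (h2.mul_right _)

/-- The Wronskian is invariant under `(p, q) ↦ (p - q, q)`. [folklore] -/
theorem wronskian_sub_self_left (p q : K[X]) : wronskian (p - q) q = wronskian p q := by
  rw [sub_eq_add_neg, wronskian_add_left, wronskian_neg_left, wronskian_self_eq_zero, neg_zero,
    add_zero]

/-- Coprime polynomials have no common root: if `s` is a root of `a` then it is not a root of `b`.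
[folklore] -/
theorem rootMultiplicity_eq_zero_of_isCoprime_of_isRoot {a b : K[X]} (hab : IsCoprime a b) {s : K}
    (ha : a.IsRoot s) : b.rootMultiplicity s = 0 := by
  rw [rootMultiplicity_eq_zero_iff]
  intro hb
  exfalso
  obtain ⟨u, v, huv⟩ := hab
  have := congrArg (eval s) huv
  rw [eval_add, eval_mul, eval_mul, ha.eq_zero, hb.eq_zero, eval_one, mul_zero, mul_zero,
    add_zero] at this
  exact zero_ne_one this

/-- `p` and `p - q` are coprime. [folklore] -/
theorem IsBelyiPair.isCoprime_left_sub (h : IsBelyiPair d p q) : IsCoprime p (p - q) := by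
  obtain ⟨u, v, huv⟩ := h.isCoprime
  exact ⟨u + v, -v, by linear_combination huv⟩

/-- `q` and `p - q` are coprime. [folklore] -/
theorem IsBelyiPair.isCoprime_right_sub (h : IsBelyiPair d p q) : IsCoprime q (p - q) := by
  obtain ⟨u, v, huv⟩ := h.isCoprime
  exact ⟨v + u, u, by linear_combination huv⟩

/-- The multiplicity of `s` in `p q (p - q)` is the sum of its multiplicities in the three (pairwise
coprime) factors, at most one of which is non-zero. [folklore] -/
theorem IsBelyiPair.rootMultiplicity_prod (h : IsBelyiPair d p q) (s : K) :
    (p * q * (p - q)).rootMultiplicity s =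
      p.rootMultiplicity s + q.rootMultiplicity s + (p - q).rootMultiplicity s := by
  rw [rootMultiplicity_mul h.prod_ne_zero, rootMultiplicity_mul (mul_ne_zero h.left_ne_zero h.right_ne_zero)]

/-- `(X - s)^{e_s - 1}` divides the Wronskian, `e_s` the multiplicity of `s` in `p q (p - q)`.
[folklore] -/
theorem pow_rootMultiplicity_prod_sub_one_dvd_wronskian (h : IsBelyiPair d p q) (s : K) :
    (X - C s) ^ ((p * q * (p - q)).rootMultiplicity s - 1) ∣ wronskian p q := by
  rw [h.rootMultiplicity_prod s]
  by_cases hp : p.IsRoot s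
  · rw [rootMultiplicity_eq_zero_of_isCoprime_of_isRoot h.isCoprime hp,
      rootMultiplicity_eq_zero_of_isCoprime_of_isRoot h.isCoprime_left_sub hp, add_zero, add_zero]
    exact pow_rootMultiplicity_sub_one_dvd_wronskian p q s
  by_cases hq : q.IsRoot s
  · rw [rootMultiplicity_eq_zero hp,
      rootMultiplicity_eq_zero_of_isCoprime_of_isRoot h.isCoprime_right_sub hq, zero_add, add_zero]
    have hdvd := pow_rootMultiplicity_sub_one_dvd_wronskian q p s
    rw [← wronskian_neg_eq, dvd_neg] at hdvd
    exact hdvd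
  · rw [rootMultiplicity_eq_zero hp, rootMultiplicity_eq_zero hq, zero_add, zero_add,
      ← wronskian_sub_self_left]
    exact pow_rootMultiplicity_sub_one_dvd_wronskian (p - q) q s

/-- The "ramification polynomial" `∏_{s} (X - s)^{e_s - 1}` over the distinct roots `s` of
`p q (p - q)` divides the Wronskian. [folklore] -/
theorem prod_pow_dvd_wronskian (h : IsBelyiPair d p q) :
    (∏ s ∈ (p * q * (p - q)).roots.toFinset,
        (X - C s) ^ ((p * q * (p - q)).rootMultiplicity s - 1)) ∣ wronskian p q := by
  apply Finset.prod_dvd_of_coprime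
  · intro s _ t _ hst
    exact (pairwise_coprime_X_sub_C (K := K) Function.injective_id hst).pow
  · intro s _
    exact pow_rootMultiplicity_prod_sub_one_dvd_wronskian h s

/-- In characteristic `0` the Wronskian of a Belyi pair is non-zero. [folklore] -/
theorem IsBelyiPair.wronskian_ne_zero [CharZero K] (h : IsBelyiPair d p q) : wronskian p q ≠ 0 := by
  intro hw
  rw [h.isCoprime.wronskian_eq_zero_iff] at hw
  obtain ⟨hp, hq⟩ := hw
  have hp' := derivative_eq_zero.mp hp
  have hq' := derivative_eq_zero.mp hq
  have := h.natDegree_eq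
  rw [hp', hq', max_self] at this
  exact (h.pos).ne' this.symm

/-- The degree of the Wronskian of a Belyi pair is at most `deg(pq(p-q)) - d - 1`.  (It is computed
from the two factors of smaller degree: `W(p,q) = W(p - q, q) = -W(q, p)`.) [folklore] -/
theorem IsBelyiPair.natDegree_wronskian_le [CharZero K] (h : IsBelyiPair d p q) :
    (wronskian p q).natDegree + d + 1 ≤ p.natDegree + q.natDegree + (p - q).natDegree := by
  have hw := h.wronskian_ne_zero
  have h1 : (wronskian p q).natDegree < p.natDegree + q.natDegree := natDegree_wronskian_lt_add hw
  have h2 : (wronskian p q).natDegree < (p - q).natDegree + q.natDegree := by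
    rw [← wronskian_sub_self_left] at hw ⊢
    exact natDegree_wronskian_lt_add hw
  have h3 : (wronskian p q).natDegree < q.natDegree + p.natDegree := by omega
  have hsum := h.two_mul_le_sum_natDegree
  have hp := h.natDegree_left_le
  have hq := h.natDegree_right_le
  have hr := h.natDegree_sub_le
  -- whichever degree is smallest, the Wronskian is bounded via the other two
  rcases h.drop with h' | h' | h'
  · -- `deg p < d`, so `deg q = deg (p - q) = d`... bound via (p, q)
    omega
  · omega
  · omega

variable [IsAlgClosed K]

/-- Over an algebraically closed field the multiplicities of the distinct roots of `F ≠ 0` sum to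
`deg F`. [folklore] -/
theorem sum_rootMultiplicity_eq_natDegree {F : K[X]} :
    ∑ s ∈ F.roots.toFinset, F.rootMultiplicity s = F.natDegree :=
  sum_rootMultiplicity_eq_natDegree_of_splits (IsAlgClosed.splits F) subset_rfl

/-- **The Wronskian of a Belyi pair** (Riemann–Hurwitz equality case): over an algebraically closed
field of characteristic `0`, `p q' - p' q = c · ∏_{s} (X - s)^{e_s - 1}` for a constant `c ≠ 0`,
the product over the distinct roots `s` of `p q (p - q)` with multiplicities `e_s`. [folklore] -/
theorem IsBelyiPair.wronskian_eq_C_mul_prod [CharZero K] (h : IsBelyiPair d p q) :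
    wronskian p q = C (wronskian p q).leadingCoeff *
      ∏ s ∈ (p * q * (p - q)).roots.toFinset,
        (X - C s) ^ ((p * q * (p - q)).rootMultiplicity s - 1) := by
  set F := p * q * (p - q) with hF
  have hmonic : (∏ s ∈ F.roots.toFinset, (X - C s) ^ (F.rootMultiplicity s - 1)).Monic :=
    monic_prod_of_monic _ _ fun s _ => (monic_X_sub_C s).pow _
  refine eq_leadingCoeff_mul_of_monic_of_dvd_of_natDegree_le hmonic (prod_pow_dvd_wronskian h) ?_
  -- degrees: `deg ∏ = Σ (e_s - 1) = deg F - (d + 1) ≥ deg W`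
  rw [natDegree_prod_of_monic _ _ fun s _ => (monic_X_sub_C s).pow _]
  simp only [natDegree_pow, natDegree_X_sub_C, mul_one]
  have hsum : ∑ s ∈ F.roots.toFinset, (F.rootMultiplicity s - 1) + F.roots.toFinset.card =
      F.natDegree := by
    rw [Finset.card_eq_sum_ones, ← Finset.sum_add_distrib, ← sum_rootMultiplicity_eq_natDegree]
    refine Finset.sum_congr rfl fun s hs => ?_
    have : 0 < F.rootMultiplicity s := by
      rw [rootMultiplicity_pos h.prod_ne_zero]
      exact (mem_roots h.prod_ne_zero).mp (Multiset.mem_toFinset.mp hs)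
    omega
  have hFdeg : F.natDegree = p.natDegree + q.natDegree + (p - q).natDegree := by
    rw [hF, natDegree_mul (mul_ne_zero h.left_ne_zero h.right_ne_zero) h.sub_ne_zero,
      natDegree_mul h.left_ne_zero h.right_ne_zero]
  have hW := h.natDegree_wronskian_le
  rw [h.card_roots] at hsum
  omega

omit [IsAlgClosed K] in
/-- The leading coefficient of the Wronskian is non-zero. [folklore] -/
theorem IsBelyiPair.leadingCoeff_wronskian_ne_zero [CharZero K] (h : IsBelyiPair d p q) :
    (wronskian p q).leadingCoeff ≠ 0 :=
  leadingCoeff_ne_zero.mpr h.wronskian_ne_zero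

/-- The roots of the Wronskian of a Belyi pair, with multiplicity: each distinct root `s` of
`p q (p - q)` taken `e_s - 1` times. [folklore] -/
theorem IsBelyiPair.roots_wronskian [CharZero K] (h : IsBelyiPair d p q) :
    (wronskian p q).roots = ∑ s ∈ (p * q * (p - q)).roots.toFinset,
      ((p * q * (p - q)).rootMultiplicity s - 1) • {s} := by
  conv_lhs => rw [h.wronskian_eq_C_mul_prod]
  rw [roots_C_mul _ h.leadingCoeff_wronskian_ne_zero, roots_prod]
  · refine Finset.sum_congr rfl fun s _ => ?_
    rw [roots_pow, roots_X_sub_C]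
  · exact Finset.prod_ne_zero_iff.mpr fun s _ => pow_ne_zero _ (X_sub_C_ne_zero s)

/-- The multiplicity of `s` as a root of the Wronskian is `e_s - 1`, where `e_s` is its multiplicity
as a root of `p q (p - q)` (so `0` off the special points). [folklore] -/
theorem IsBelyiPair.rootMultiplicity_wronskian [CharZero K] (h : IsBelyiPair d p q) (s : K) :
    (wronskian p q).rootMultiplicity s = (p * q * (p - q)).rootMultiplicity s - 1 := by
  rw [← count_roots, h.roots_wronskian, Multiset.count_sum']
  simp only [Multiset.count_nsmul, Multiset.count_singleton]
  by_cases hs : s ∈ (p * q * (p - q)).roots.toFinset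
  · rw [Finset.sum_eq_single s]
    · simp
    · intro t _ hts
      simp [Ne.symm hts]
    · intro hs'; exact absurd hs hs'
  · rw [Finset.sum_eq_zero]
    · have : (p * q * (p - q)).rootMultiplicity s = 0 := by
        rw [rootMultiplicity_eq_zero_iff]
        intro hroot
        exact absurd (Multiset.mem_toFinset.mpr ((mem_roots h.prod_ne_zero).mpr hroot)) hs
      rw [this]
      simp
    · intro t ht
      have : s ≠ t := fun hst => hs (hst ▸ ht)
      simp [this]

/-- Counting a filtered multiset through its distinct elements. [folklore] -/
theorem card_filter_eq_sum_count {α : Type*} [DecidableEq α] (M : Multiset α) (P : α → Prop)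
    [DecidablePred P] :
    Multiset.card (M.filter P) = ∑ s ∈ M.toFinset.filter P, M.count s := by
  rw [← Multiset.toFinset_sum_count_eq (M.filter P), Multiset.toFinset_filter]
  refine Finset.sum_congr rfl fun s hs => ?_
  rw [Multiset.count_filter_of_pos (Finset.mem_filter.mp hs).2]

omit [IsAlgClosed K] in
/-- **Counting roots of the Wronskian.**  For every predicate `P` on `K` (typically membership in a
disc), the number of roots of the Wronskian of a Belyi pair satisfying `P`, counted with
multiplicity, is the number of roots of `p q (p - q)` satisfying `P` (with multiplicity) minus the
number of DISTINCT such roots: "`n(W) = M₀ + M₁ + M_∞ - N`". [folklore] -/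
theorem IsBelyiPair.card_roots_wronskian_filter [IsAlgClosed K] [CharZero K] (h : IsBelyiPair d p q)
    (P : K → Prop) :
    Multiset.card ((wronskian p q).roots.filter P) +
        ((p * q * (p - q)).roots.toFinset.filter P).card =
      Multiset.card ((p * q * (p - q)).roots.filter P) := by
  set F := p * q * (p - q) with hF
  have hF0 : F ≠ 0 := h.prod_ne_zero
  have hsub : (wronskian p q).roots.toFinset.filter P ⊆ F.roots.toFinset.filter P := by
    intro s hs
    rw [Finset.mem_filter, Multiset.mem_toFinset, mem_roots h.wronskian_ne_zero] at hs
    rw [Finset.mem_filter, Multiset.mem_toFinset, mem_roots hF0]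
    refine ⟨?_, hs.2⟩
    have h1 : 0 < (wronskian p q).rootMultiplicity s :=
      (rootMultiplicity_pos h.wronskian_ne_zero).mpr hs.1
    rw [h.rootMultiplicity_wronskian, ← hF] at h1
    have h2 : 0 < F.rootMultiplicity s := by omega
    exact (rootMultiplicity_pos hF0).mp h2
  have hW : Multiset.card ((wronskian p q).roots.filter P) =
      ∑ s ∈ F.roots.toFinset.filter P, (F.rootMultiplicity s - 1) := by
    rw [card_filter_eq_sum_count, Finset.sum_subset hsub]
    · refine Finset.sum_congr rfl fun s _ => ?_
      rw [count_roots, h.rootMultiplicity_wronskian]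
    · intro s _ hs
      rw [Finset.mem_filter, not_and_or] at hs
      rcases hs with hs | hs
      · rw [count_roots]
        exact rootMultiplicity_eq_zero fun hr =>
          hs (Multiset.mem_toFinset.mpr ((mem_roots h.wronskian_ne_zero).mpr hr))
      · exact absurd (Finset.mem_filter.mp ‹s ∈ F.roots.toFinset.filter P›).2 hs
  have hFc : Multiset.card (F.roots.filter P) = ∑ s ∈ F.roots.toFinset.filter P, F.rootMultiplicity s := by
    rw [card_filter_eq_sum_count]
    exact Finset.sum_congr rfl fun s _ => count_roots F
  rw [hW, hFc, Finset.card_eq_sum_ones, ← Finset.sum_add_distrib]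
  refine Finset.sum_congr rfl fun s hs => ?_
  have : 0 < F.rootMultiplicity s := by
    rw [rootMultiplicity_pos hF0]
    exact (mem_roots hF0).mp (Multiset.mem_toFinset.mp (Finset.mem_filter.mp hs).1)
  omega

omit [IsAlgClosed K] in
/-- The roots of `p q (p - q)` with multiplicity are those of `p`, of `q` and of `p - q` together.
[folklore] -/
theorem IsBelyiPair.roots_prod (h : IsBelyiPair d p q) :
    (p * q * (p - q)).roots = p.roots + q.roots + (p - q).roots := by
  rw [roots_mul h.prod_ne_zero, roots_mul (mul_ne_zero h.left_ne_zero h.right_ne_zero)]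

end Wronskian

end Literature.NumberTheory.DiophantineGeometry
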